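import Mathlib.Data.Finsupp.Basic
import Literature.IUT.LogThetaLattice.BiCoresRealified
import Literature.IUT.HodgeArakelov.GoodPrimeFrobenioidMonoids
import Literature.IUT.HodgeArakelov.GoodPrimeFrobenioidMonoidsProofs
import Literature.IUT.HodgeArakelov.RealifiedMonoidRigidity
import HarnessLib

/-!
# [IUTchIII] Thm 1.5 (v) / [IUTchII] Cor 4.10 (v): the rigidity of `D^⊢ ↦ (D^⊩(D^⊢), Prime ⥲ V̲, {ρ_v})`
# — kernel form of the consumer-side hypothesis `RealifiedRigidAt`, and the `ℝ_{≥0}`-coordinate rigidity behind it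

Proof-only companion (abc-iut cell, D-0067 wave 4, seat abc-iut-w4-d009; node `IUTchIII:Thm1.5(v)`; no new
definitions, no typer file edited) of `BiCoresRealified.lean` (abc-iut-L6-t3, p408172).

S. Mochizuki, *Inter-universal Teichmüller theory III*, kurims manuscript (May 2020), Thm 1.5 (v) pp. 50–51:
"the poly-isomorphisms of `D^⊢`-prime-strips `^{n,m}D^⊢_△ ⥲ ^{n′,m′}D^⊢_△` induced by the full poly-isomorphisms of
(i), (ii) induce [cf. [IUTchII], Corollaries 4.5, (ii); 4.10, (v)] an isomorphism of collections of data
`(D^⊩(^{n,m}D^⊢_△), Prime(D^⊩(^{n,m}D^⊢_△)) ⥲ V̲, {^{n,m}ρ_{D^⊩,v}}_v) ⥲ (D^⊩(^{n′,m′}D^⊢_△), …)`"; *II* (Dec 2020),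
Cor 4.10 (v) p. 160: "The full poly-isomorphism `†D^⊢_△ ⥲ ‡D^⊢_△` of (iv) induces [cf. Corollary 4.5, (ii)] an
isomorphism of collections of data"; Cor 4.5 (ii) p. 132 (the functorial algorithm
`†D^⊢ ↦ (D^⊩(†D^⊢), Prime(D^⊩(†D^⊢)) ⥲ V̲, {†ρ_{D^⊩,v}}_v)`); [IUTchI] Ex 3.5 (i)–(iii) pp. 84–86 (the divisor monoid
`Φ_{C^⊩_mod} ≅ ⊕_{v ∈ V_mod} ℝ_{≥0}·log^⊢_mod(p_v)`, `ρ_v : Φ_{C^⊩_mod,v} ⥲ Φ^rlf_{C^⊢_v} ≅ ℝ_{≥0}`); [IUTchII] Prop 4.2 (ii)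
p. 124 / 4.4 (ii) p. 130 ("a unique isomorphism of monoids … that maps the distinguished element … to the
distinguished element"). Claim key `Mochizuki2012` DISPUTED (D-0012).

STATE OF THE TREE. `BiCoresRealified.lean` types the printed SINGULAR "an isomorphism" as the named `Prop`
`BiCoricData.Thm15vSingleIso` and proves it EQUIVALENT to the consumer-side hypothesis
`BiCoricData.RealifiedRigidAt` ("parallel isomorphisms of `D^⊢`-prime-strips induce the same isomorphism of
`D^⊩`-data") at every pair `^{n,m}D^⊢_△`, `^{n′,m′}D^⊢_△` (`thm15vSingleIso_iff_rigid`); the INPUT [IUTchII] Cor 4.10 (v)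
is recorded by its typer (abc-iut-L6-t2, `HodgeArakelov/ThetaGauLinks.lean`, module docstring) as "not kernel-statable
until the objects `D^⊩(−)` are real", and abc-iut-L6-t3 (STATUS 2026-08-25T23:12:16Z, SUBDAG Thm-15 row r13 /
Cor-23 rows r16, r18) names exactly this junction as open. THIS FILE supplies the two halves of that junction:

§1 (over the interface `BiCoricData`, pure category theory). The kernel form of Cor 4.10 (v)
"the FULL poly-isomorphism induces AN isomorphism": `RealifiedRigidAt X Y` (for `X ≅ Y` inhabited) holds
IFF the functorial algorithm `D^⊩(−)` (`realified`) KILLS EVERY AUTOMORPHISM of the `D^⊢`-prime-strip `X`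
(`realifiedRigidAt_iff_mapIso_aut`); hence `Thm15vSingleIso ↔ ∀ H, ∀ a ∈ Aut(^{n,m}D^⊢_△), D^⊩(a) = id`
(`thm15vSingleIso_iff_mapIso_aut`). Sufficient criteria in the shape the instantiation will use: the data
objects `(D^⊩(D^⊢_△), Prime ⥲ V̲, {ρ_v})` have no non-identity automorphism (`thm15vSingleIso_of_target_rigid`), or a
FAITHFUL "coordinates" functor on `D^⊩`-data sends every `D^⊩(a)` to an identity
(`thm15vSingleIso_of_faithful_coordinates`). Consequence: under the printed clause THE isomorphisms
`biCoricRealifiedIso` of `BiCoresRealified.lean` form a COMMUTING SYSTEM along the lattice — they compose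
transitively and invert (`biCoricRealifiedIso_trans`, `biCoricRealifiedIso_symm`), i.e. `(D^⊩(−), Prime ⥲ V̲, {ρ_v})`
is a bi-coric invariant in the strict sense.

§2 (the model-level content, in the `ℝ_{≥0}`-coordinates the tree uses for `Φ_{C^⊩}`: abc-iut-L5-t2
`InitialThetaData.PhiMod = V_mod →₀ ℝ≥0`, `logMod`, `rho`; abc-iut-L6-t2 `PointedHalfLine`; abc-iut-L4-t3
`(ℝ^⊢_{≥0})_v` with its Frobenius element). An automorphism of the data `(Φ, Prime(Φ) ⥲ V̲, {ρ_v}_v)` is, in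
coordinates, an additive automorphism of `⊕_v ℝ_{≥0}` (resp. `Π_v ℝ_{≥0}`) that (a) respects `Prime(Φ) ⥲ V̲`, i.e. acts
prime-by-prime, and (b) commutes with every `ρ_v`, whose target `(ℝ^⊢_{≥0})_v` is rigidified by the CANONICAL
Frobenius element `log^{D}_Φ(p_v)` — so each prime component fixes a positive element. Such an automorphism is
the IDENTITY (`finsupp_addEquiv_eq_refl_of_primewise_of_fixes`, `pi_addEquiv_eq_refl_of_primewise_of_fixes`),
by the rank-one rigidity `NNRealAddHom.eq_of_apply_eq` (an additive self-map of `ℝ_{≥0}` is determined by one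
nonzero value; `RealifiedMonoidRigidity.lean`) — the content of [IUTchII] Prop 4.2 (ii)/4.4 (ii) "unique
isomorphism … that maps the distinguished element to the distinguished element", one prime at a time. This is
what makes the automorphism groups of §1's targets trivial once `BiCoricData.realified` is instantiated by REAL
`D^⊩`-data in these coordinates (today `realified`/`RFrob` are interface fields; [IUTchII] Cor 4.5 is the SLOT
structure `Cor45Statements`): the instantiation then discharges `RealifiedRigidAt` by
`thm15vSingleIso_of_faithful_coordinates` + §2.

HONEST FRAMING: bookkeeping over interfaces (§1) and elementary real-monoid algebra (§2); nothing here asserts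
a disputed claim or takes a side on [IUTchIII] Cor 3.12. typed ≠ proved: `RealifiedRigidAt` for the glued
log-theta-lattice data remains a HYPOTHESIS until `realified` is real (plan/GAP-LEDGER.md row of this seat).
-/

namespace Literature.IUT.LogThetaLattice

open CategoryTheory
open Literature.IUT.HodgeTheaters

universe u

namespace BiCoricData

variable {S : StripFrame.{u}} (B : BiCoricData S)

/-! ### §1. [IUTchII] Cor 4.10 (v) as "`D^⊩(−)` kills the automorphisms of `D^⊢_△`" -/

/-- **IUTchII:Cor4.10(v)** (kurims p. 160) / **IUTchIII:Thm1.5(v)** (kurims p. 50), kernel form: for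
`D^⊢`-prime-strips `X ≅ Y`, "the full poly-isomorphism `X ⥲ Y` induces AN isomorphism of collections of data
`(D^⊩(X), Prime ⥲ V̲, {ρ_v}) ⥲ (D^⊩(Y), …)`" (`RealifiedRigidAt X Y`: parallel isomorphisms are identified by
`D^⊩(−)`) IFF the functorial algorithm `D^⊩(−)` sends every automorphism of `X` to the identity.
[claim: Mochizuki2012, status: disputed] -/
theorem realifiedRigidAt_iff_mapIso_aut {X Y : S.Dv} (e : X ≅ Y) :
    B.RealifiedRigidAt X Y ↔ ∀ a : X ≅ X, B.realified.mapIso a = Iso.refl _ := by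
  constructor
  · intro h a
    have h1 : B.realified.mapIso a ≪≫ B.realified.mapIso e = Iso.refl _ ≪≫ B.realified.mapIso e := by
      rw [← Functor.mapIso_trans, Iso.refl_trans]
      exact h (a ≪≫ e) e
    have h2 := congrArg (fun f => f ≪≫ (B.realified.mapIso e).symm) h1
    simpa only [Iso.trans_assoc, Iso.self_symm_id, Iso.trans_refl] using h2
  · intro h d d'
    have hd : d = (d ≪≫ d'.symm) ≪≫ d' := by
      rw [Iso.trans_assoc, Iso.symm_self_id, Iso.trans_refl]
    rw [hd, Functor.mapIso_trans, h (d ≪≫ d'.symm), Iso.refl_trans]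

/-- **IUTchIII:Thm1.5(v)** (kurims p. 50) at a pair of NON-isomorphic `D^⊢`-prime-strips the rigidity clause is
vacuous (along the log-theta-lattice all `^{n,m}D^⊢_△` ARE isomorphic: Thm 1.5 (i), (ii)).
[claim: Mochizuki2012, status: disputed] -/
theorem realifiedRigidAt_of_isEmpty {X Y : S.Dv} (h : IsEmpty (X ≅ Y)) : B.RealifiedRigidAt X Y :=
  fun d => (h.false d).elim

/-- **IUTchII:Cor4.10(v)** (kurims p. 160) the diagonal case: `RealifiedRigidAt X X` says exactly that
`D^⊩(−)` kills `Aut(X)`. [claim: Mochizuki2012, status: disputed] -/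
theorem realifiedRigidAt_self_iff (X : S.Dv) :
    B.RealifiedRigidAt X X ↔ ∀ a : X ≅ X, B.realified.mapIso a = Iso.refl _ :=
  B.realifiedRigidAt_iff_mapIso_aut (Iso.refl X)

/-- **IUTchII:Cor4.10(v)** (kurims p. 160) rigidity at `X` against itself gives rigidity at `X` against every
`Y`. [claim: Mochizuki2012, status: disputed] -/
theorem realifiedRigidAt_of_self {X : S.Dv} (h : B.RealifiedRigidAt X X) (Y : S.Dv) :
    B.RealifiedRigidAt X Y := by
  by_cases hne : Nonempty (X ≅ Y)
  · obtain ⟨e⟩ := hne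
    exact (B.realifiedRigidAt_iff_mapIso_aut e).mpr ((B.realifiedRigidAt_self_iff X).mp h)
  · exact B.realifiedRigidAt_of_isEmpty (not_nonempty_iff.mp hne)

/-- **IUTchII:Cor4.10(v)** (kurims p. 160) conversely, rigidity against some isomorphic `Y` gives rigidity at `X`
against itself. [claim: Mochizuki2012, status: disputed] -/
theorem realifiedRigidAt_self_of {X Y : S.Dv} (h : B.RealifiedRigidAt X Y) (e : X ≅ Y) :
    B.RealifiedRigidAt X X :=
  (B.realifiedRigidAt_self_iff X).mpr ((B.realifiedRigidAt_iff_mapIso_aut e).mp h)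

/-- **IUTchII:Cor4.10(v)** (kurims p. 160) the rigidity is symmetric in the two `D^⊢`-prime-strips.
[claim: Mochizuki2012, status: disputed] -/
theorem realifiedRigidAt_symm {X Y : S.Dv} (h : B.RealifiedRigidAt X Y) : B.RealifiedRigidAt Y X := by
  intro d d'
  have h' := congrArg Iso.symm (h d.symm d'.symm)
  simpa only [Functor.mapIso_symm, Iso.symm_symm_eq] using h'

/-- **IUTchIII:Thm1.5(v)** (kurims p. 50) ⟺ **IUTchII:Cor4.10(v)** (kurims p. 160) in kernel form: the printed
"induce AN isomorphism of collections of data `(D^⊩(^{n,m}D^⊢_△), Prime ⥲ V̲, {ρ_{D^⊩,v}}) ⥲ (D^⊩(^{n′,m′}D^⊢_△), …)`"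
holds IFF, for every `D`-`Θ^{±ell}NF`-Hodge theater of the frame, the functorial algorithm `D^⊩(−)` of
[IUTchII] Cor 4.5 (ii) sends EVERY automorphism of the `D^⊢`-prime-strip `D^⊢_△` to the identity — the exact
statement an instantiation of `realified` has to prove. [claim: Mochizuki2012, status: disputed] -/
theorem thm15vSingleIso_iff_mapIso_aut :
    B.Thm15vSingleIso ↔
      ∀ (H : S.DHT) (a : B.dvDeltaOf H ≅ B.dvDeltaOf H), B.realified.mapIso a = Iso.refl _ := by
  rw [thm15vSingleIso_iff_rigid]
  constructor
  · intro h H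
    exact (B.realifiedRigidAt_self_iff _).mp (h H H)
  · intro h H H'
    exact B.realifiedRigidAt_of_self ((B.realifiedRigidAt_self_iff _).mpr (h H)) _

/-- **IUTchII:Cor4.5(ii)** (kurims p. 132) / **IUTchIII:Thm1.5(v)**: SUFFICIENT CRITERION (rigid targets) — if
the collections of data `(D^⊩(^{n,m}D^⊢_△), Prime(D^⊩) ⥲ V̲, {ρ_{D^⊩,v}}_v)` admit no non-identity automorphism (the
model-level content of §2: each `ρ_v` pins the rank-one factor at `v` to `(ℝ^⊢_{≥0})_v` with its canonical
Frobenius element), then Thm 1.5 (v)'s "an isomorphism" holds. [claim: Mochizuki2012, status: disputed] -/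
theorem thm15vSingleIso_of_target_rigid
    (h : ∀ (H : S.DHT) (f : B.realified.obj (B.dvDeltaOf H) ≅ B.realified.obj (B.dvDeltaOf H)),
      f = Iso.refl _) :
    B.Thm15vSingleIso :=
  B.thm15vSingleIso_iff_mapIso_aut.mpr fun H a => h H (B.realified.mapIso a)

/-- **IUTchII:Cor4.5(ii)** (kurims p. 132) / **IUTchIII:Thm1.5(v)**: the same with the rigidity phrased as
`Subsingleton` automorphism types. [claim: Mochizuki2012, status: disputed] -/
theorem thm15vSingleIso_of_subsingleton_aut
    [h : ∀ H : S.DHT, Subsingleton (B.realified.obj (B.dvDeltaOf H) ≅ B.realified.obj (B.dvDeltaOf H))] :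
    B.Thm15vSingleIso :=
  B.thm15vSingleIso_of_target_rigid fun H f => (h H).elim f _

/-- **IUTchII:Cor4.5(ii)** (kurims p. 132) / **IUTchIII:Thm1.5(v)**: SUFFICIENT CRITERION (faithful
coordinates) — if a FAITHFUL functor `U` on `D^⊩`-data ("read the data in coordinates": `Φ ↦ ⊕_v ℝ_{≥0}`,
§2) sends `D^⊩(a)` to an identity for every automorphism `a` of every `^{n,m}D^⊢_△`, then Thm 1.5 (v)'s
"an isomorphism" holds. This is the shape in which §2 discharges the clause once `realified` is real.
[claim: Mochizuki2012, status: disputed] -/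
theorem thm15vSingleIso_of_faithful_coordinates {E : Type*} [Category E] (U : B.RFrob ⥤ E) [U.Faithful]
    (h : ∀ (H : S.DHT) (a : B.dvDeltaOf H ≅ B.dvDeltaOf H),
      U.map (B.realified.map a.hom) = 𝟙 (U.obj (B.realified.obj (B.dvDeltaOf H)))) :
    B.Thm15vSingleIso := by
  refine B.thm15vSingleIso_iff_mapIso_aut.mpr fun H a => Iso.ext (U.map_injective ?_)
  rw [Functor.mapIso_hom, h H a, Iso.refl_hom, U.map_id]

/-- **IUTchIII:Thm1.5(v)** (kurims p. 50) under the printed clause, `D^⊩(−)` identifies ALL isomorphisms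
between the `D^⊢`-prime-strips of two Hodge theaters of the frame (not only automorphisms).
[claim: Mochizuki2012, status: disputed] -/
theorem realified_mapIso_eq_of_thm15vSingleIso (h : B.Thm15vSingleIso) {H H' : S.DHT}
    (d d' : B.dvDeltaOf H ≅ B.dvDeltaOf H') : B.realified.mapIso d = B.realified.mapIso d' :=
  (B.thm15vSingleIso_iff_rigid.mp h) H H' d d'

/-- **IUTchIII:Thm1.5(v)** (kurims pp. 50–51) "bi-coric": under the printed clause THE isomorphisms
`(D^⊩(^{p}D^⊢_△), …) ⥲ (D^⊩(^{q}D^⊢_△), …)` of `BiCoresRealified.biCoricRealifiedIso` compose TRANSITIVELY along the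
lattice — `(p → q) ≫ (q → r) = (p → r)` — i.e. they form a commuting system of identifications (a constant
invariant of all the arrows). [claim: Mochizuki2012, status: disputed] -/
theorem biCoricRealifiedIso_trans (h : B.Thm15vSingleIso) {H₁ H₂ H₃ : S.DHT}
    (h₁₂ : Nonempty (B.dvDeltaOf H₁ ≅ B.dvDeltaOf H₂)) (h₂₃ : Nonempty (B.dvDeltaOf H₂ ≅ B.dvDeltaOf H₃))
    (h₁₃ : Nonempty (B.dvDeltaOf H₁ ≅ B.dvDeltaOf H₃)) :
    B.biCoricRealifiedIso h₁₂ ≪≫ B.biCoricRealifiedIso h₂₃ = B.biCoricRealifiedIso h₁₃ := by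
  rw [biCoricRealifiedIso, biCoricRealifiedIso, biCoricRealifiedIso, ← Functor.mapIso_trans]
  exact B.realified_mapIso_eq_of_thm15vSingleIso h _ _

/-- **IUTchIII:Thm1.5(v)** (kurims pp. 50–51) … and invert: `(q → p) = (p → q)⁻¹`.
[claim: Mochizuki2012, status: disputed] -/
theorem biCoricRealifiedIso_symm (h : B.Thm15vSingleIso) {H₁ H₂ : S.DHT}
    (h₁₂ : Nonempty (B.dvDeltaOf H₁ ≅ B.dvDeltaOf H₂)) (h₂₁ : Nonempty (B.dvDeltaOf H₂ ≅ B.dvDeltaOf H₁)) :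
    (B.biCoricRealifiedIso h₁₂).symm = B.biCoricRealifiedIso h₂₁ := by
  rw [biCoricRealifiedIso, biCoricRealifiedIso, ← Functor.mapIso_symm]
  exact B.realified_mapIso_eq_of_thm15vSingleIso h _ _

/-- **IUTchIII:Thm1.5(v)** (kurims p. 50) … and at one Hodge theater THE isomorphism is the identity.
[claim: Mochizuki2012, status: disputed] -/
theorem biCoricRealifiedIso_self (h : B.Thm15vSingleIso) (H : S.DHT)
    (hH : Nonempty (B.dvDeltaOf H ≅ B.dvDeltaOf H)) : B.biCoricRealifiedIso hH = Iso.refl _ := by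
  rw [biCoricRealifiedIso, ← Functor.mapIso_refl]
  exact B.realified_mapIso_eq_of_thm15vSingleIso h _ _

end BiCoricData

end Literature.IUT.LogThetaLattice

/-! ### §2. The model-level rigidity in `ℝ_{≥0}`-coordinates ([IUTchII] Cor 4.5 (ii) via Prop 4.2 (ii)/4.4 (ii)) -/

namespace Literature.IUT.HodgeArakelov

open scoped NNReal

namespace NNRealAddHom

/-- **IUTchII:Prop4.2(ii)** (kurims p. 124) "a unique isomorphism of monoids … that maps the distinguished
element … to the distinguished element", endomorphism form: an additive self-map of `ℝ_{≥0}` FIXING one nonzero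
element is the identity. [claim: Mochizuki2012, status: disputed] -/
theorem eq_id_of_apply_eq_self (f : ℝ≥0 →+ ℝ≥0) {a : ℝ≥0} (ha : a ≠ 0) (h : f a = a) :
    f = AddMonoidHom.id ℝ≥0 :=
  eq_of_apply_eq f (AddMonoidHom.id ℝ≥0) ha h

/-- **IUTchII:Prop4.2(ii)** (kurims p. 124) the same for isomorphisms of monoids `ℝ_{≥0} ⥲ ℝ_{≥0}`.
[claim: Mochizuki2012, status: disputed] -/
theorem addEquiv_eq_refl_of_apply_eq_self (e : ℝ≥0 ≃+ ℝ≥0) {a : ℝ≥0} (ha : a ≠ 0) (h : e a = a) :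
    e = AddEquiv.refl ℝ≥0 :=
  addEquiv_eq_of_apply_eq e (AddEquiv.refl ℝ≥0) ha h

end NNRealAddHom

namespace RealifiedDataRigidity

variable {V : Type*}

/-- **IUTchII:Cor4.5(ii)** (kurims p. 132) with [IUTchI] Ex 3.5 (iii) p. 86, model level, DIRECT-SUM coordinates
`Φ_{D^⊩} = ⊕_{v} ℝ_{≥0}·[v]` (abc-iut-L5-t2's `PhiMod`, finitely supported functions): an additive ENDOMORPHISM of
`V →₀ ℝ≥0` which (a) respects `Prime(Φ) ⥲ V̲` — it maps each prime component `ℝ_{≥0}·[v]` to itself, through some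
additive `e_v` — and (b) is compatible with the rigidifications `ρ_v` — each `e_v` fixes the (positive) coordinate
`d v` of the canonical Frobenius element `log^{D}_Φ(p_v)` pulled back along `ρ_v` — IS THE IDENTITY.
[claim: Mochizuki2012, status: disputed] -/
theorem finsupp_addMonoidHom_eq_id_of_primewise_of_fixes (f : (V →₀ ℝ≥0) →+ (V →₀ ℝ≥0))
    (ev : V → (ℝ≥0 →+ ℝ≥0)) (hf : ∀ v x, f (Finsupp.single v x) = Finsupp.single v (ev v x))
    (d : V → ℝ≥0) (hd : ∀ v, d v ≠ 0) (hfix : ∀ v, ev v (d v) = d v) :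
    f = AddMonoidHom.id _ := by
  refine Finsupp.addHom_ext fun v x => ?_
  rw [hf v x, NNRealAddHom.eq_id_of_apply_eq_self (ev v) (hd v) (hfix v)]
  rfl

/-- **IUTchII:Cor4.5(ii)** (kurims p. 132) / **IUTchII:Cor4.10(v)** (kurims p. 160), model level, direct-sum
coordinates: an AUTOMORPHISM of the data `(Φ = ⊕_v ℝ_{≥0}·[v], Prime(Φ) ⥲ V̲, {ρ_v}_v)` — an additive automorphism
acting prime-by-prime and fixing the Frobenius coordinates — is the identity: "induces AN isomorphism".
[claim: Mochizuki2012, status: disputed] -/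
theorem finsupp_addEquiv_eq_refl_of_primewise_of_fixes (e : (V →₀ ℝ≥0) ≃+ (V →₀ ℝ≥0))
    (ev : V → (ℝ≥0 →+ ℝ≥0)) (he : ∀ v x, e (Finsupp.single v x) = Finsupp.single v (ev v x))
    (d : V → ℝ≥0) (hd : ∀ v, d v ≠ 0) (hfix : ∀ v, ev v (d v) = d v) :
    e = AddEquiv.refl _ := by
  have h := finsupp_addMonoidHom_eq_id_of_primewise_of_fixes e.toAddMonoidHom ev he d hd hfix
  exact AddEquiv.ext fun x => DFunLike.congr_fun h x

/-- **IUTchII:Cor4.5(ii)** (kurims p. 132), model level, PRODUCT coordinates `Π_{v} ℝ_{≥0}` (abc-iut-L6-t2's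
`V → ℝ≥0` convention in `GlobalGaussianFrobenioids.weightedDiagonalHom_local`): an additive endomorphism acting
coordinate-by-coordinate (`Prime ⥲ V̲`) through maps fixing the positive Frobenius coordinates (`ρ_v`) is the
identity. [claim: Mochizuki2012, status: disputed] -/
theorem pi_addMonoidHom_eq_id_of_primewise_of_fixes (f : (V → ℝ≥0) →+ (V → ℝ≥0))
    (ev : V → (ℝ≥0 →+ ℝ≥0)) (hf : ∀ x v, f x v = ev v (x v))
    (d : V → ℝ≥0) (hd : ∀ v, d v ≠ 0) (hfix : ∀ v, ev v (d v) = d v) :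
    f = AddMonoidHom.id _ := by
  refine AddMonoidHom.ext fun x => funext fun v => ?_
  rw [hf x v, NNRealAddHom.eq_id_of_apply_eq_self (ev v) (hd v) (hfix v)]
  rfl

/-- **IUTchII:Cor4.5(ii)** (kurims p. 132) / **IUTchII:Cor4.10(v)** (kurims p. 160), model level, product
coordinates: an automorphism of `(Π_v ℝ_{≥0}, Prime ⥲ V̲, {ρ_v})` acting coordinatewise and fixing the Frobenius
coordinates is the identity. [claim: Mochizuki2012, status: disputed] -/
theorem pi_addEquiv_eq_refl_of_primewise_of_fixes (e : (V → ℝ≥0) ≃+ (V → ℝ≥0))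
    (ev : V → (ℝ≥0 →+ ℝ≥0)) (he : ∀ x v, e x v = ev v (x v))
    (d : V → ℝ≥0) (hd : ∀ v, d v ≠ 0) (hfix : ∀ v, ev v (d v) = d v) :
    e = AddEquiv.refl _ := by
  have h := pi_addMonoidHom_eq_id_of_primewise_of_fixes e.toAddMonoidHom ev he d hd hfix
  exact AddEquiv.ext fun x => DFunLike.congr_fun h x

/-- **IUTchII:Cor4.5(ii)** (kurims p. 132), model level, the rigidification read through `ρ_v` itself: if at each
prime the coordinate map `e_v` COMMUTES with an injective comparison `ρ_v : ℝ_{≥0} → M_v` into a monoid carrying a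
CANONICAL element `m_v = ρ_v(d_v)`, `d_v ≠ 0` (the Frobenius element of `(ℝ^⊢_{≥0})_v`, [AbsTopIII] Prop 5.8 (iii);
`ρ_v` = abc-iut-L5-t2's `InitialThetaData.rho`, a nonzero scalar), and the induced map on `M_v` fixes `m_v`, then
`e_v` fixes `d_v` — so the previous lemmas apply. [claim: Mochizuki2012, status: disputed] -/
theorem fixes_of_rho_compat {M : Type*} (ρ : ℝ≥0 → M) (hρ : Function.Injective ρ) (e : ℝ≥0 →+ ℝ≥0)
    (eM : M → M) (hcomm : ∀ x, ρ (e x) = eM (ρ x)) {d : ℝ≥0} (hfixM : eM (ρ d) = ρ d) : e d = d :=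
  hρ ((hcomm d).trans hfixM)

/-- **IUTchII:Prop4.2(ii)** (kurims p. 124) in the tree's `PointedHalfLine` dress (abc-iut-L6-t2,
`GoodPrimeFrobenioidMonoids.lean`): the only isomorphism of monoids `ℝ_{≥0} ⥲ ℝ_{≥0}` carrying the distinguished
element of `A` to ITSELF is the identity (`scaleIso A A = refl`). [claim: Mochizuki2012, status: disputed] -/
theorem _root_.Literature.IUT.HodgeArakelov.PointedHalfLine.scaleIso_self (A : PointedHalfLine) :
    PointedHalfLine.scaleIso A A = AddEquiv.refl ℝ≥0 :=
  NNRealAddHom.addEquiv_eq_refl_of_apply_eq_self _ A.pt_pos.ne' (PointedHalfLine.scaleIso_pt A A)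

/-- **IUTchII:Prop4.2(ii)** (kurims p. 124): hence every isomorphism of monoids `ℝ_{≥0} ⥲ ℝ_{≥0}` fixing the
distinguished element of `A` is the identity (`IsoUnique A A` unfolded; abc-iut-L6-t2's `isoUnique_holds` is the
two-object version). [claim: Mochizuki2012, status: disputed] -/
theorem _root_.Literature.IUT.HodgeArakelov.PointedHalfLine.eq_refl_of_apply_pt (A : PointedHalfLine)
    (e : ℝ≥0 ≃+ ℝ≥0) (he : e A.pt = A.pt) : e = AddEquiv.refl ℝ≥0 :=
  NNRealAddHom.addEquiv_eq_refl_of_apply_eq_self e A.pt_pos.ne' he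

end RealifiedDataRigidity

end Literature.IUT.HodgeArakelov

/-! ## Appended (v4): abc-iut-w4-d006's three new theorems of p412183 (F12-b), by agreement (INBOX 2026-08-25T23:45:59Z).
History: p411847 (this seat) ACCEPTED b5e5743fa1e6 → overwritten by the whole-file p412183 (d006, same path; withdraw
lost the race) → v4 restores p411847's text (+1 import for `isoUnique_holds`) and appends d006's complement. -/

namespace Literature.IUT.HodgeArakelov

namespace PointedHalfLine

open scoped NNReal

/-- **IUTchII:Prop4.2(ii)** (kurims p.124; also Prop 4.4 (ii) p.130) "a unique isomorphism of monoids … that maps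
the distinguished element … to the distinguished element": two additive automorphisms of `ℝ_{≥0}` carrying the
distinguished element of `A` to that of `B` coincide (both are `scaleIso A B`, by the PROVED `isoUnique_holds`).
(abc-iut-w4-d006, p412183.) [claim: Mochizuki2012, status: disputed] -/
theorem addEquiv_eq_of_map_pt (A B : PointedHalfLine) (e e' : ℝ≥0 ≃+ ℝ≥0) (he : e A.pt = B.pt)
    (he' : e' A.pt = B.pt) : e = e' :=
  (isoUnique_holds A B e he).trans (isoUnique_holds A B e' he').symm

/-- **IUTchII:Cor4.5(ii)** (kurims p.132; with Cor 4.10 (v) p.160 "induces an isomorphism of collections of data")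
the `V`-indexed form: two families of additive automorphisms of `ℝ_{≥0}` that carry, index by index, the
distinguished elements of `A` to those of `B` coincide — isomorphisms of data "(realified Frobenioid, `Prime ⥲ V̲`,
`{ρ_v}`)" compatible with the pointed local data are unique. (d006, p412183.) [claim: Mochizuki2012, status: disputed] -/
theorem family_addEquiv_eq_of_map_pt {V : Type*} (A B : V → PointedHalfLine) (e e' : V → (ℝ≥0 ≃+ ℝ≥0))
    (he : ∀ v, e v (A v).pt = (B v).pt) (he' : ∀ v, e' v (A v).pt = (B v).pt) : e = e' :=
  funext fun v => addEquiv_eq_of_map_pt (A v) (B v) (e v) (e' v) (he v) (he' v)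

end PointedHalfLine

end Literature.IUT.HodgeArakelov

namespace Literature.IUT.LogThetaLattice

open CategoryTheory
open Literature.IUT.HodgeTheaters

namespace BiCoricData

variable {S : StripFrame} (B : BiCoricData S)

/-- **IUTchIII:Thm1.5(v)** (kurims pp.50–51) under "automorphisms of `D^⊢_△` act trivially on `D^⊩(−)`", at every
pair of Hodge theaters the bi-coric realified poly-isomorphism IS the single isomorphism `D^⊩(d)` for any
`d : ^{†}D^⊢_△ ⥲ ^{‡}D^⊢_△`, and the transported class between the Frobenius-like data `(†C^⊩_△, …)`, `(‡C^⊩_△, …)` is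
the double `ℝ_{>0}`-orbit class of it ("compatible … with the `ℝ_{>0}`-orbits of … [IUTchII], Corollary 4.6, (ii)").
(d006, p412183; via `realifiedRigidAt_of_self`.) [claim: Mochizuki2012, status: disputed] -/
theorem realifiedTransport_eq_orbit_of_mapIso_aut
    (h : ∀ (H : S.DHT) (α : B.dvDeltaOf H ≅ B.dvDeltaOf H), B.realified.mapIso α = Iso.refl _)
    (X Y : S.HT) (d : B.dvDeltaOf (S.htToD.obj X) ≅ B.dvDeltaOf (S.htToD.obj Y)) :
    B.biCoricRealifiedPolyIso (S.htToD.obj X) (S.htToD.obj Y) = PolyIso.single (B.realified.mapIso d) ∧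
    B.realifiedTransport X Y =
      ((B.realifiedKummer X).comp (PolyIso.single (B.realified.mapIso d))).comp (B.realifiedKummer Y).symm :=
  have hr : B.RealifiedRigidAt (B.dvDeltaOf (S.htToD.obj X)) (B.dvDeltaOf (S.htToD.obj Y)) :=
    B.realifiedRigidAt_of_self ((B.realifiedRigidAt_self_iff _).mpr (h _)) _
  ⟨B.biCoricRealifiedPolyIso_eq_single hr d, B.realifiedTransport_eq_orbit hr d⟩

end BiCoricData

end Literature.IUT.LogThetaLattice

/-! ## Appended (v4, §3): `ρ`-compatibility form of §2 (the Hom shape of abc-iut-L6-t2's announced `DVdashDatum`) -/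
namespace Literature.IUT.HodgeArakelov.RealifiedDataRigidity

open scoped NNReal

variable {V : Type*} {M : V → Type*}

/-- **IUTchII:Cor4.5(ii)** (kurims pp. 131–132) / **IUTchII:Cor4.10(v)** (p. 160), direct-sum coordinates,
`ρ`-COMPATIBILITY form: a prime-by-prime additive endomorphism of `⊕_v ℝ_{≥0}·[v]` whose components commute with
INJECTIVE comparison maps `ρ_v : ℝ_{≥0} → M_v` is the identity. [claim: Mochizuki2012, status: disputed] -/
theorem finsupp_addMonoidHom_eq_id_of_primewise_of_rho_compat (ρ : ∀ v, ℝ≥0 → M v)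
    (hρ : ∀ v, Function.Injective (ρ v)) (f : (V →₀ ℝ≥0) →+ (V →₀ ℝ≥0)) (ev : V → (ℝ≥0 →+ ℝ≥0))
    (hf : ∀ v x, f (Finsupp.single v x) = Finsupp.single v (ev v x))
    (hcomp : ∀ v x, ρ v (ev v x) = ρ v x) : f = AddMonoidHom.id _ := by
  refine Finsupp.addHom_ext fun v x => ?_
  rw [hf v x, show ev v x = x from hρ v (hcomp v x)]
  rfl

/-- **IUTchII:Cor4.5(ii)** / **IUTchII:Cor4.10(v)** / **IUTchIII:Thm1.5(v)**, the same for AUTOMORPHISMS: a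
prime-by-prime automorphism of `(⊕_v ℝ_{≥0}·[v], Prime ⥲ V̲, {ρ_v})` commuting with injective `ρ_v` is the
identity — "induces AN isomorphism". [claim: Mochizuki2012, status: disputed] -/
theorem finsupp_addEquiv_eq_refl_of_primewise_of_rho_compat (ρ : ∀ v, ℝ≥0 → M v)
    (hρ : ∀ v, Function.Injective (ρ v)) (e : (V →₀ ℝ≥0) ≃+ (V →₀ ℝ≥0)) (ev : V → (ℝ≥0 →+ ℝ≥0))
    (he : ∀ v x, e (Finsupp.single v x) = Finsupp.single v (ev v x))
    (hcomp : ∀ v x, ρ v (ev v x) = ρ v x) : e = AddEquiv.refl _ := by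
  have h := finsupp_addMonoidHom_eq_id_of_primewise_of_rho_compat ρ hρ e.toAddMonoidHom ev he hcomp
  exact AddEquiv.ext fun x => DFunLike.congr_fun h x

end Literature.IUT.HodgeArakelov.RealifiedDataRigidity
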